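import Summits.BirchSwinnertonDyer.BirchSwinnertonDyer.Theses.EisensteinPrimes
import Summits.BirchSwinnertonDyer.Rank1Residual.X2.RankZeroExact
import Literature.NumberTheory.EllipticCurves.BSDShaProofs
import Literature.NumberTheory.EllipticCurves.BSDRootNumberSmallConductorProofs
import Literature.Barriers.BirchSwinnertonDyer.HeegnerPointsRankOneProofs
import HarnessLib

/-!
# Crux `MazurMCOnCellB` (stmt-BirchSwinnertonDyer-19033): the crux IS the cell-B target of row A10, and
# per pair its conclusion follows from ONE non-trivial element of `Ш(E)[3^∞]` (the `Ш`-lower-bound socket)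

Cell `bsd-eis` (FULL-BSD rank-≤1 programme D-0033, HOME `run/shared/lean/pub/bsd-eis/`), seat
`bsd-eis-k5-c3` gen 6 (prover), item stmt-BirchSwinnertonDyer-19033 (`--supports`; the item is NOT
closed by this file, the skeleton of record `mudescent` is untouched). Route
`route-BirchSwinnertonDyer-EisensteinPrimes` (rung K5), crux 3 = row A10 = corner X2b (`r_an = 0`, odd
MULTIPLICATIVE Eisenstein `p`, `¬ GVPar`; 83 split + 44 non-split cells at `p = 3`, 7 still open).

WHAT IS RECORDED, BY THE ROUTE'S NAMES (bookkeeping over the b2b cell's kernel theorems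
`X2/RankZeroConverse.lean`, `X2/RankZeroExact.lean` — Wuthrich 2014 Thm. 16 at a multiplicative prime
`hWu` + Stein–Wuthrich 2013 Thm. 6.1 with THE §4.2 heights `hJs hJn hHs hHn` + Greenberg–Stevens `hGS`
+ GZK `hGZK` + modularity `hmod hpar`, every one a binder of the route's `PublishedInputs`):
* `mazurMCOnCellB_iff_targetB_of_publishedFacts` — the crux
  `Summit.…Theses.EisensteinPrimes.MazurMCOnCellB` (VERBATIM) ⟺ `X2.TargetB` (Miller's `BSD(E,p)` at
  every X2b pair): crux 3 of the K5 route and the ladder's cell-B target are ONE statement on the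
  published record (`X2.targetB_iff_forall_cellB_mazurMainConjectureAt`); `mazurMCOnCellB_of_targetB`,
  `targetB_of_mazurMCOnCellB` the two directions by name.
* THE `Ш`-LOWER-BOUND SOCKET (new): `mazurMainConjectureAt_of_cellB_of_pow_dvd_card_sha` — at an X2b
  pair, a certificate `p^a ∣ #Ш(E/ℚ)[p^∞]` with `ord_p #Ш_an ≤ a` gives the crux's conclusion
  `X2.MazurMainConjectureAt W p`; and `mazurMainConjectureAt_of_cellB_of_sha_primary_nontrivial` —
  with Cassels–Tate (`hCT : WeierstrassCurve.exists_casselsTate_pairing`, Cassels 1962 / Silverman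
  X.4.14: `#Ш` is a square when finite, tree `isSquare_card_sha_of_finite_of_casselsTate`) ONE
  non-trivial element of `Ш(E/ℚ)[p^∞]` suffices whenever `ord_p #Ш_an ≤ 2` — the shape of every open
  A10 cell of record (`#Ш_an(E₀) = 9` at `(165525c1, 3)`, `(384450d1, 3)`, …). This is the kernel
  end of the proposed VISIBILITY road (a 3-congruent relative's rational point made visible in
  `Ш(E₀)[3]`, Mazur–Rubin 2015 / Cremona–Mazur): whatever produces the element, this theorem turns it
  into the crux's conclusion at the pair.

HONEST FRAMING: nothing booked, no label moves, BSD proved for NO curve; `X2.TargetB` is itself OPEN;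
the crux stays open class-wide. Theorems only; every published input is a hypothesis BY NAME.

References: [Wuthrich2014] Thm. 16 (p. 397), Prop. 21 (p. 400); [SteinWuthrich2013] Thm. 6.1 (p. 20);
[GreenbergStevens1993]; [SilvermanAEC2009] Thm. X.4.14; [Cassels1962ArithmeticIV]; [Miller2011LMS] Def. 1.1.
-/

set_option autoImplicit false
set_option linter.dupNamespace false

namespace Summit.BirchSwinnertonDyer.BirchSwinnertonDyer.Theorems.EisensteinPrimesMazurMCOnCellBShaLowerBound

open Summit.BirchSwinnertonDyer.Rank1Residual
  Literature.NumberTheory.EllipticCurves Literature.NumberTheory.EllipticCurves.Rank1Residual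
  Literature.NumberTheory.EllipticCurves.Rank1Residual.Typed
  Literature.NumberTheory.EllipticCurves.ModularForms
  Literature.NumberTheory.EllipticCurves.Wuthrich2014 Literature.NumberTheory.EllipticCurves.SteinWuthrich2013

/-! ## §1. Crux 3 ⟺ the cell-B target, by name -/

/-- **Crux 3 ⟺ the cell-B target, from published facts by name.** Granted Wuthrich 2014 Thm. 16 at a
multiplicative prime (`hWu`), Stein–Wuthrich 2013 Thm. 6.1 (`hJs hJn`) with THE §4.2 heights
(`hHs hHn`), Greenberg–Stevens (`hGS`), Gross–Zagier–Kolyvagin (`hGZK`) and modularity (`hmod hpar`)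
— every one a binder of the route's `PublishedInputs` —, the crux
`Summit.…Theses.EisensteinPrimes.MazurMCOnCellB` (Mazur's main conjecture at EVERY X2b pair) holds
IF AND ONLY IF `X2.TargetB` (Miller's `BSD(E,p)` at every X2b pair). Bookkeeping over
`X2.targetB_iff_forall_cellB_mazurMainConjectureAt` (`X2.MissingInputB = X2.MazurMainConjectureAt`).
[cite: Wuthrich2014, Thm. 16 (p. 397)] [cite: SteinWuthrich2013, Thm. 6.1 (p. 20)]
[cite: GreenbergStevens1993] [cite: Miller2011LMS, Def. 1.1 (arXiv:1010.2431 p. 3)] -/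
theorem mazurMCOnCellB_iff_targetB_of_publishedFacts
    (hWu : thm16_charIdeal_dvd_multiplicative_of_reducible)
    (hJs : thm61_splitMultiplicative) (hJn : thm61_nonsplitMultiplicative)
    (hHs : exists_isSplitMultCanonical) (hHn : exists_isMultCanonical)
    (hGZK : rank_eq_analyticRank_of_analyticRank_le_one) (hmod : exists_isNewformOf)
    (hpar : nonempty_modularParametrizationData)
    (hGS : ∀ (W : WeierstrassCurve ℚ) [W.IsElliptic] [W.IsGloballyMinimal] (p : ℕ) [Fact p.Prime],
      greenberg_stevens (W := W) (p := p)) :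
    Summit.BirchSwinnertonDyer.BirchSwinnertonDyer.Theses.EisensteinPrimes.MazurMCOnCellB ↔
      X2.TargetB :=
  (X2.targetB_iff_forall_cellB_mazurMainConjectureAt hWu hJs hJn hHs hHn hGZK
    (WeierstrassCurve.hasEntireLFunction_rat_of_exists_isNewformOf hmod) hpar hGS).symm

/-- **The cell-B target gives the crux** (the direction a booking of row A10 uses), same facts.
[cite: Wuthrich2014, Thm. 16 (p. 397)] [cite: SteinWuthrich2013, Thm. 6.1 (p. 20)] [cite: GreenbergStevens1993] -/
theorem mazurMCOnCellB_of_targetB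
    (hWu : thm16_charIdeal_dvd_multiplicative_of_reducible)
    (hJs : thm61_splitMultiplicative) (hJn : thm61_nonsplitMultiplicative)
    (hHs : exists_isSplitMultCanonical) (hHn : exists_isMultCanonical)
    (hGZK : rank_eq_analyticRank_of_analyticRank_le_one) (hmod : exists_isNewformOf)
    (hpar : nonempty_modularParametrizationData)
    (hGS : ∀ (W : WeierstrassCurve ℚ) [W.IsElliptic] [W.IsGloballyMinimal] (p : ℕ) [Fact p.Prime],
      greenberg_stevens (W := W) (p := p))
    (hB : X2.TargetB) :
    Summit.BirchSwinnertonDyer.BirchSwinnertonDyer.Theses.EisensteinPrimes.MazurMCOnCellB :=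
  (mazurMCOnCellB_iff_targetB_of_publishedFacts hWu hJs hJn hHs hHn hGZK hmod hpar hGS).mpr hB

/-- **The crux gives the cell-B target** (the forward glue, Stein–Wuthrich Thm. 6.1 etc.), by name.
[cite: SteinWuthrich2013, Thm. 6.1 (p. 20) and §4.2] [cite: GreenbergStevens1993] [cite: Miller2011LMS, Def. 1.1] -/
theorem targetB_of_mazurMCOnCellB
    (hWu : thm16_charIdeal_dvd_multiplicative_of_reducible)
    (hJs : thm61_splitMultiplicative) (hJn : thm61_nonsplitMultiplicative)
    (hHs : exists_isSplitMultCanonical) (hHn : exists_isMultCanonical)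
    (hGZK : rank_eq_analyticRank_of_analyticRank_le_one) (hmod : exists_isNewformOf)
    (hpar : nonempty_modularParametrizationData)
    (hGS : ∀ (W : WeierstrassCurve ℚ) [W.IsElliptic] [W.IsGloballyMinimal] (p : ℕ) [Fact p.Prime],
      greenberg_stevens (W := W) (p := p))
    (hMC : Summit.BirchSwinnertonDyer.BirchSwinnertonDyer.Theses.EisensteinPrimes.MazurMCOnCellB) :
    X2.TargetB :=
  (mazurMCOnCellB_iff_targetB_of_publishedFacts hWu hJs hJn hHs hHn hGZK hmod hpar hGS).mp hMC

/-! ## §2. The `Ш`-lower-bound socket at a single X2b pair -/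

section Socket

variable (W : WeierstrassCurve ℚ) [W.IsElliptic] [W.IsGloballyMinimal] (p : ℕ) [Fact p.Prime]

/-- **A `Ш` lower-bound certificate gives the crux's conclusion at an X2b pair.** `CellB W p`
(`r_an = 0`, `p ≠ 2`, `E[p]` reducible, multiplicative — either sign), `#Ш(E/ℚ)_an = q ∈ ℚ` with
`ord_p q ≤ a`, and a certificate `p^a ∣ #Ш(E/ℚ)[p^∞]` ⟹ `X2.MazurMainConjectureAt W p`. Chain:
`p^a ∣ #Ш[p^∞]` and `Ш` finite (GZK) give `a ≤ ord_p #Ш[p^∞] = ord_p #Ш`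
(`padicValNat_card_addPrimaryComponent`), hence the typed lower bound `Typed.MissingLowerBoundAt W p`,
hence the main conjecture at the pair by `X2.mazurMainConjectureAt_of_missingLowerBoundAt_of_red`.
[cite: Wuthrich2014, Thm. 16 (p. 397)] [cite: SteinWuthrich2013, Thm. 6.1 (p. 20)]
[cite: GreenbergStevens1993] [cite: Miller2011LMS, Def. 1.1 (arXiv:1010.2431 p. 3)] -/
theorem mazurMainConjectureAt_of_cellB_of_pow_dvd_card_sha
    (hWu : thm16_charIdeal_dvd_multiplicative_of_reducible)
    (hJs : thm61_splitMultiplicative) (hJn : thm61_nonsplitMultiplicative)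
    (hHs : exists_isSplitMultCanonical) (hHn : exists_isMultCanonical)
    (hGZK : rank_eq_analyticRank_of_analyticRank_le_one) (hmod : exists_isNewformOf)
    (hGS : greenberg_stevens (W := W) (p := p)) (hc : X2.CellB W p)
    {q : ℚ} {a : ℕ} (hq : shaAn W = (q : ℂ)) (hqa : padicValRat p q ≤ a)
    (hdvd : p ^ a ∣ Nat.card (AddCommGroup.primaryComponent W.sha p)) :
    X2.MazurMainConjectureAt W p := by
  have hpP : p.Prime := Fact.out
  haveI : Finite W.sha := (hGZK W (by rw [hc.1]; exact zero_le_one)).2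
  haveI : Finite (AddCommGroup.primaryComponent W.sha p) := inferInstance
  have hpos : 0 < Nat.card (AddCommGroup.primaryComponent W.sha p) := Nat.card_pos
  have ha : a ≤ padicValNat p (Nat.card (AddCommGroup.primaryComponent W.sha p)) :=
    (padicValNat_dvd_iff_le hpos.ne').mp hdvd
  have hsha : padicValNat p (Nat.card (AddCommGroup.primaryComponent W.sha p)) =
      padicValNat p W.shaOrder := by
    rw [padicValNat_card_addPrimaryComponent]; rfl
  have hlow : MissingLowerBoundAt W p := ⟨q, hq, by rw [← hsha]; exact_mod_cast hqa.trans (by exact_mod_cast ha)⟩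
  exact X2.mazurMainConjectureAt_of_missingLowerBoundAt_of_red hWu hJs hJn hHs hHn hGZK
    (WeierstrassCurve.hasEntireLFunction_rat_of_exists_isNewformOf hmod) W p hGS hc.2.1.1 hc.2.1.2.2
    hc.2.1.2.1 hc.1 hlow

/-- **ONE non-trivial element of `Ш(E/ℚ)[p^∞]` suffices when `ord_p #Ш_an ≤ 2`** (the VISIBILITY
socket): at an X2b pair with `#Ш(E/ℚ)_an = q`, `ord_p q ≤ 2` — every open A10 cell of record has
`#Ш_an(E₀) = 9` at `p = 3` — a non-trivial `p`-primary part of `Ш(E/ℚ)` gives the crux's conclusion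
`X2.MazurMainConjectureAt W p`. Chain: `Ш(E/ℚ)` is finite (GZK at `r_an = 0`), so by Cassels–Tate
(`hCT`, Cassels 1962 / Silverman X.4.14; tree `isSquare_card_sha_of_finite_of_casselsTate`) `#Ш = n²`;
`#Ш[p^∞] > 1` is a positive power of `p`, so `p ∣ n²`, `p ∣ n`, `p² ∣ #Ш`, i.e. `p² ∣ #Ш[p^∞]`; then
`mazurMainConjectureAt_of_cellB_of_pow_dvd_card_sha` with `a = 2`. The element itself is the per-pair
input (e.g. the Kummer class of a rational point of a `p`-congruent relative, made visible in `Ш(E)`).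
[cite: SilvermanAEC2009, Thm. X.4.14] [cite: Wuthrich2014, Thm. 16 (p. 397)]
[cite: SteinWuthrich2013, Thm. 6.1 (p. 20)] [cite: GreenbergStevens1993] -/
theorem mazurMainConjectureAt_of_cellB_of_sha_primary_nontrivial
    (hCT : WeierstrassCurve.exists_casselsTate_pairing (K := ℚ))
    (hWu : thm16_charIdeal_dvd_multiplicative_of_reducible)
    (hJs : thm61_splitMultiplicative) (hJn : thm61_nonsplitMultiplicative)
    (hHs : exists_isSplitMultCanonical) (hHn : exists_isMultCanonical)
    (hGZK : rank_eq_analyticRank_of_analyticRank_le_one) (hmod : exists_isNewformOf)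
    (hGS : greenberg_stevens (W := W) (p := p)) (hc : X2.CellB W p)
    {q : ℚ} (hq : shaAn W = (q : ℂ)) (hq2 : padicValRat p q ≤ 2)
    (hne : 1 < Nat.card (AddCommGroup.primaryComponent W.sha p)) :
    X2.MazurMainConjectureAt W p := by
  have hpP : p.Prime := Fact.out
  haveI : Finite W.sha := (hGZK W (by rw [hc.1]; exact zero_le_one)).2
  haveI : Finite (AddCommGroup.primaryComponent W.sha p) := inferInstance
  -- `#Ш = n²` (Cassels–Tate) and `#Ш[p^∞] = p^e` with `e = ord_p #Ш ≥ 1`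
  obtain ⟨n, hn⟩ := WeierstrassCurve.isSquare_card_sha_of_finite_of_casselsTate hCT W
  have hcardpow := card_addPrimaryComponent_eq_pow (A := W.sha) p
  set e := (Nat.card W.sha).factorization p with he
  have he1 : 1 ≤ e := by
    by_contra h0
    have : e = 0 := by omega
    rw [this, pow_zero] at hcardpow
    omega
  have hcard0 : Nat.card W.sha ≠ 0 := (Nat.card_pos (α := W.sha)).ne'
  have hn0 : n ≠ 0 := by
    rintro rfl
    exact hcard0 (by rw [hn])
  -- `ord_p #Ш = 2 · ord_p n ≥ 1`, hence `≥ 2`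
  have hfac : (Nat.card W.sha).factorization p = 2 * n.factorization p := by
    rw [hn, show n * n = n ^ 2 from (sq n).symm, Nat.factorization_pow]
    simp [two_mul]
  have h2 : 2 ≤ (Nat.card W.sha).factorization p := by omega
  have hdvd : p ^ 2 ∣ Nat.card (AddCommGroup.primaryComponent W.sha p) := by
    rw [hcardpow]
    exact pow_dvd_pow p h2
  exact mazurMainConjectureAt_of_cellB_of_pow_dvd_card_sha W p hWu hJs hJn hHs hHn hGZK hmod hGS hc hq
    (by exact_mod_cast hq2) hdvd

end Socket

end Summit.BirchSwinnertonDyer.BirchSwinnertonDyer.Theorems.EisensteinPrimesMazurMCOnCellBShaLowerBound
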